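import Summits.BirchSwinnertonDyer.BirchSwinnertonDyer.Theorems.ResidualThetaTransportAtTwoSignedMuSeedAtTwoPlusJetTranslation
import Literature.NumberTheory.EllipticCurves.FormalGroupNegProofs
import HarnessLib

/-!
# `[−1](t) = t + t⁴ + t¹⁰ + O(t¹³)` on the formal group of `y² + y = x³` in characteristic `2` — an ingredient of stub J4
# of the seed line `jet-character-sums` (crux `SignedMuSeedAtTwoPlus` stmt-BirchSwinnertonDyer-21438; Kμ⁺ stmt-BirchSwinnertonDyer-20689;
# route `ResidualThetaTransportAtTwo`), for the tree's `WeierstrassCurve.formalNeg`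

Cell `bsd-wall`, width seat `bsd-wall-rtt-p4-w2` (g12). THEOREMS ONLY (no `def`, no named fact, no `sorry`); helper `--supports` the
seed crux; nothing about any habitat curve is asserted; BSD is not proved by this. The line card
`Cruxes/SignedMuSeedAtTwoPlus/Lines/jet-character-sums.md` lists among the inputs of J4 (`LevelOneWallCriterion`) the formal-group facts
«`[−2]t = t⁴`, `[−1]t = t + t⁴ + t¹⁰ + …`» for `Ẽ : y² + y = x³`. The first is in the tree (the Lubin–Tate structure of the tilt line,
`…TiltFormalGroup` / `formalGroupLaw_eq_ltF'`); this file proves the second for the tree's formal inverse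
`WeierstrassCurve.formalNeg` (`PadicSigma.lean`; AEC IV.1 p. 118: `i(z) = −z/(1 − a₁z − a₃w(z))`):

* `formalNeg_mul_one_sub_formalW` — for `Ẽ = ⟨0, 0, 1, 0, 0⟩` over any ring: `i · (1 − w) = −X` (from `formalNeg_eq`,
  `formalNegDenom_mul_invOfUnit`);
* **`X_pow_dvd_formalNeg_sub`** — in characteristic `2`: `X¹³ ∣ i − (X + X⁴ + X¹⁰)`, i.e. `[−1](t) = t + t⁴ + t¹⁰ + O(t¹³)`
  (`i = X/(1 + w) = X Σ wᵏ` with `w ≡ X³ + X⁶ (mod X¹²)` from `…JetTranslation.X_pow_dvd_formalW_sub`).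

References: [SilvermanAEC2009] IV.1 (p. 118, the inverse `i(z)`); the card (stub J4, inputs).
-/

set_option autoImplicit false
set_option linter.dupNamespace false

noncomputable section

open PowerSeries

namespace Summit.BirchSwinnertonDyer.BirchSwinnertonDyer.Theorems.SignedMuAtTwo.JetCharacterSums

variable (R : Type*) [CommRing R]

/-- For `Ẽ = y² + y = x³` (any ring): `i(z) · (1 − w(z)) = −z`, `i = formalNeg`, `w = formalW`. [cite: SilvermanAEC2009, IV.1.1] -/
theorem formalNeg_mul_one_sub_formalW :
    (⟨0, 0, 1, 0, 0⟩ : WeierstrassCurve R).formalNeg * (1 - (⟨0, 0, 1, 0, 0⟩ : WeierstrassCurve R).formalW) = -X := by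
  have hDI := (⟨0, 0, 1, 0, 0⟩ : WeierstrassCurve R).formalNegDenom_mul_invOfUnit
  have hneg := (⟨0, 0, 1, 0, 0⟩ : WeierstrassCurve R).formalNeg_eq
  simp only [map_zero, zero_mul, sub_zero, map_one, one_mul] at hDI hneg
  rw [hneg]
  linear_combination (-X) * hDI

variable [CharP R 2]

/-- **`[−1](t) = t + t⁴ + t¹⁰ + O(t¹³)`** on the formal group of `y² + y = x³` in characteristic `2`:
`X¹³ ∣ formalNeg − (X + X⁴ + X¹⁰)`. [cite: SilvermanAEC2009, IV.1.1] -/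
theorem X_pow_dvd_formalNeg_sub :
    X ^ 13 ∣ (⟨0, 0, 1, 0, 0⟩ : WeierstrassCurve R).formalNeg - (X + X ^ 4 + X ^ 10) := by
  obtain ⟨r, hr⟩ := X_pow_dvd_formalW_sub R
  have hDI := (⟨0, 0, 1, 0, 0⟩ : WeierstrassCurve R).formalNegDenom_mul_invOfUnit
  simp only [map_zero, zero_mul, sub_zero, map_one, one_mul] at hDI
  have hi := formalNeg_mul_one_sub_formalW R
  have hw : (⟨0, 0, 1, 0, 0⟩ : WeierstrassCurve R).formalW = X ^ 3 + X ^ 6 + X ^ 12 * r := by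
    linear_combination hr
  -- `(i − P)(1 − w) = X¹³ · (1 + X³ + r (1 + X³ + X⁹))` in characteristic `2`
  have key : ((⟨0, 0, 1, 0, 0⟩ : WeierstrassCurve R).formalNeg - (X + X ^ 4 + X ^ 10)) *
      (1 - (⟨0, 0, 1, 0, 0⟩ : WeierstrassCurve R).formalW) = X ^ 13 * (1 + X ^ 3 + r * (1 + X ^ 3 + X ^ 9)) := by
    linear_combination hi + (X + X ^ 4 + X ^ 10) * hw + (-X + X ^ 7) * two_eq_zero_powerSeries (R := R)
  -- multiply by the inverse of `1 − w`
  have hmul := congrArg (· * PowerSeries.invOfUnit (1 - (⟨0, 0, 1, 0, 0⟩ : WeierstrassCurve R).formalW) 1) key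
  rw [mul_assoc, hDI, mul_one] at hmul
  rw [hmul, mul_assoc]
  exact dvd_mul_right _ _

end Summit.BirchSwinnertonDyer.BirchSwinnertonDyer.Theorems.SignedMuAtTwo.JetCharacterSums
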